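import Summits.Ventures.PercRepro.S1FiveCircuitChain
import Summits.Ventures.PercRepro.S1TriangleQ2
import Summits.Ventures.PercRepro.S1CellCaps5

/-!
# PercRepro — THE CELL `(9, 14)`: an `e`-free core of rank `9` with `23` points satisfies `RLS` at level `4`
(p2, gen 20; SUBCLAIM-S1 §6.4)

The three-cap cell inequality `cellOK14 9 14 42 611 6339` holds by kernel: `s₃ ≤ cq2 14 = 42` (LEMMA Q‴,
S1TriangleQ2), `s₄ ≤ avgChain 14 = 611` (S1CoreCapChain) and `s₅ ≤ avgChain5 14 = 6339` (S1FiveCircuitChain) — the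
two unconditional averaging chains together; the exact-rational twin (mining/p2/g20/both20.py) reads `0.9973`
(`1.2413` with the caps of v40). The row `p = 9` of the `q = 4` window now ends at `(9, 13)`.

* `cell_nine_fourteen_chains` — `cellOK14 9 14 42 611 6339 = true` (decide + kernel);
* **`c025_core_nine_fourteen`** — the cell.
Axioms: standard.
-/

open scoped Matroid

namespace PercRepro

namespace S1

open Set

variable {α : Type}

/-- The capped cell `(9, 14)` with `s₃ ≤ 42`, `s₄ ≤ 611`, `s₅ ≤ 6339`, by kernel. -/
theorem cell_nine_fourteen_chains : cellOK14 9 14 42 611 6339 = true := by decide +kernel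

/-- The chain value `avgChain 14 = 611`. -/
theorem avgChain_fourteen : avgChain 14 = 611 := by decide

/-- **THE CELL `(9, 14)`**: an `e`-free core of rank `9` with `23` points satisfies `RLS` at level `4`. -/
theorem c025_core_nine_fourteen (M : Matroid α) [M.Finite] (hR : M.eRank = (9 : ℕ)) (hn : M.E.ncard = 23)
    (hfree : ∀ e ∈ M.E, ∃ A ⊆ M.E \ {e}, e ∉ M.closure A ∧ e ∉ M.closure ((M.E \ {e}) \ A)) :
    ThmN.RLS M 9 4 := by
  have hd : M.E.encard = M.eRank + ((14 : ℕ) : ℕ∞) := by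
    rw [hR, ← M.ground_finite.cast_ncard_eq, hn]
    push_cast
    ring
  have hP : {C : Set α | M.IsCircuit C ∧ C.ncard = 3}.ncard ≤ 42 := by
    have h := core_ncard_triangles_le_cq2 M hfree hd
    rwa [show cq2 14 = 42 by decide] at h
  have hS : {C : Set α | M.IsCircuit C ∧ C.ncard = 4}.ncard ≤ 611 := by
    have h := ncard_fourCircuits_le_avgChain 14 M hfree hd
    rwa [avgChain_fourteen] at h
  have hS5 : {C : Set α | M.IsCircuit C ∧ C.ncard = 5}.ncard ≤ 6339 :=
    ncard_fiveCircuits_le_avgChain5_fourteen M hfree (by exact_mod_cast hd)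
  exact rls_of_cellOK14 M 9 14 42 611 6339 (by norm_num) hR hn hfree hP hS hS5 (by norm_num)
    cell_nine_fourteen_chains

end S1

end PercRepro
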